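import Literature.AnabelianGeometry.EtaleTheta.SettingModelChiCyclotomes
import HarnessLib

/-!
# The theta quotients `(Π^tp_X)^Θ ↠ (Π^tp_X)^ell` of a tempered curve (abc-iut-L2-d1's `CurveTheta` package): they are
# QUOTIENT MAPS (clause (R3)), both targets are HAUSDORFF, `Δ_Θ` is CLOSED, and they stay Galois-countable — GENERICALLY

Mochizuki, *The étale theta function …*, Publ. RIMS **45** (2009) [EtTh], §1, PRIMS p. 238 («`(Π^tp_X)^Θ`», «`(Π^tp_X)^ell`»,
«`Δ_Θ`», topological groups) [cite: MochizukiEtTh2009, §1 p.12].  abc-iut cell, seat abc-iut-w5-d111 (gen 4).  PROOF-ONLY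
(0 definitions, 0 instances), GENERIC over ANY `X : TemperedCurve p` — so that every root record built on the `CurveTheta`
package (abc-iut-L2-t1's `ThetaSetting.modelχ`, abc-iut-L2-t5's stage-2 `modelχq`, …) gets clause (R3) and the
Hausdorff / closedness / countability facts BY NAME (the `modelχ` instances are this seat's p433963; `(Π^tp_X)^Θ` Hausdorff is
abc-iut-L2-t8's `CurveTheta.t2Space_GTheta`, p433637, imported here):

* **`isQuotientMap_toTheta`**, `isOpenQuotientMap_toTheta`, **`isQuotientMap_thetaToEll`**, `isOpenMap_thetaToEll` — (R3);
* **`t2Space_GEll`**, `isClosed_ker_thetaToEll` — `(Π^tp_X)^ell` Hausdorff, `Δ_Θ = Ker(thetaToEll)` closed in `(Π^tp_X)^Θ`;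
* `secondCountableTopology_GTheta`, `secondCountableTopology_GEll` — Galois-countability passes to the quotients.
Classical topological group theory; nothing of [EtTh] asserted; no side taken on [IUTchIII] Cor. 3.12.
-/

noncomputable section

namespace Literature.AnabelianGeometry.EtaleTheta.CurveTheta

open Literature.AnabelianGeometry.SemiGraphs _root_.Topology

variable {p : ℕ} [Fact p.Prime] (X : TemperedCurve p)

/-- **(R3), first half, generically**: `Π^tp_X ↠ (Π^tp_X)^Θ` is a quotient map (it is `QuotientGroup.mk'`).
[cite: MochizukiEtTh2009, §1 p.12] -/
theorem isQuotientMap_toTheta : IsQuotientMap (toTheta X) :=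
  QuotientGroup.isQuotientMap_mk (thetaKer X)

/-- `Π^tp_X ↠ (Π^tp_X)^Θ` is an OPEN quotient map. [cite: MochizukiEtTh2009, §1 p.12] -/
theorem isOpenQuotientMap_toTheta : IsOpenQuotientMap (toTheta X) :=
  QuotientGroup.isOpenQuotientMap_mk

/-- **(R3), second half, generically**: `(Π^tp_X)^Θ ↠ (Π^tp_X)^ell` is a quotient map (its composite with the quotient
map `toTheta` is the quotient map `Π^tp_X ↠ Π^tp_X / ellKer`). [cite: MochizukiEtTh2009, §1 p.12] -/
theorem isQuotientMap_thetaToEll : IsQuotientMap (thetaToEll X) := by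
  have hcomp : ((thetaToEll X) ∘ (toTheta X) : X.PiTemp → GEll X) =
      (QuotientGroup.mk' (ellKer X) : X.PiTemp → GEll X) :=
    congrArg (fun f : X.PiTemp →* GEll X => (f : X.PiTemp → GEll X)) (thetaToEll_comp X)
  have hq : IsQuotientMap ((thetaToEll X) ∘ (toTheta X)) := by
    rw [hcomp]
    exact QuotientGroup.isQuotientMap_mk (ellKer X)
  exact IsQuotientMap.of_comp (continuous_toTheta X) (continuous_thetaToEll X) hq

/-- `(Π^tp_X)^Θ ↠ (Π^tp_X)^ell` is an open map (a surjective continuous homomorphism that is a quotient map between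
topological groups; directly: images of opens lift to saturated opens along `toTheta`). [cite: MochizukiEtTh2009, §1 p.12] -/
theorem isOpenMap_thetaToEll : IsOpenMap (thetaToEll X) := by
  intro U hU
  -- `thetaToEll '' U = mk_ell '' (toTheta ⁻¹' U)`
  have himage : (thetaToEll X) '' U = (QuotientGroup.mk' (ellKer X) : X.PiTemp → GEll X) '' ((toTheta X) ⁻¹' U) := by
    ext y
    constructor
    · rintro ⟨u, hu, rfl⟩
      obtain ⟨g, rfl⟩ := toTheta_surjective X u
      exact ⟨g, hu, by rw [← thetaToEll_comp]; rfl⟩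
    · rintro ⟨g, hg, rfl⟩
      exact ⟨toTheta X g, hg, by rw [← thetaToEll_comp]; rfl⟩
  rw [himage]
  exact QuotientGroup.isOpenMap_coe _ ((continuous_toTheta X).isOpen_preimage U hU)

/-- **`(Π^tp_X)^ell` is HAUSDORFF** (quotient by the closed normal `ellKer`). [cite: MochizukiEtTh2009, §1 p.12] -/
theorem t2Space_GEll : T2Space (GEll X) := by
  -- `ellKer = toHat⁻¹([Δ_X,Δ_X]⁻)` is closed (pull-back of a closure along the continuous `toHat`)
  haveI : IsClosed (ellKer X : Set X.PiTemp) := (Subgroup.isClosed_topologicalClosure _).preimage X.toHat.continuous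
  infer_instance

/-- `Δ_Θ = Ker((Π^tp_X)^Θ ↠ (Π^tp_X)^ell)` is CLOSED in `(Π^tp_X)^Θ`. [cite: MochizukiEtTh2009, §1 p.12] -/
theorem isClosed_ker_thetaToEll : IsClosed ((thetaToEll X).ker : Set (GTheta X)) := by
  haveI := t2Space_GEll X
  have h : ((thetaToEll X).ker : Set (GTheta X)) = (thetaToEll X) ⁻¹' {1} := by
    ext x; simp [MonoidHom.mem_ker]
  rw [h]
  exact isClosed_singleton.preimage (continuous_thetaToEll X)

/-- `(Π^tp_X)^Θ` is Galois-countable if `Π^tp_X` is. [cite: MochizukiEtTh2009, §1 p.12] -/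
theorem secondCountableTopology_GTheta [SecondCountableTopology X.PiTemp] : SecondCountableTopology (GTheta X) :=
  inferInstance

/-- `(Π^tp_X)^ell` is Galois-countable if `Π^tp_X` is. [cite: MochizukiEtTh2009, §1 p.12] -/
theorem secondCountableTopology_GEll [SecondCountableTopology X.PiTemp] : SecondCountableTopology (GEll X) :=
  inferInstance

end Literature.AnabelianGeometry.EtaleTheta.CurveTheta

end
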